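import Summits.ResolutionOfSingularities.ResolutionOfSingularities.Theorems.FrobeniusClosingPatchingRelPerfectTwoPlanesChartThree
import Summits.ResolutionOfSingularities.ResolutionOfSingularities.Theorems.FrobeniusClosingPatchingRelPerfectTwoPlanesChartOne
import HarnessLib

/-!
# Crux `PatchingRelPerfect` (stmt-ResolutionOfSingularities-16161), chain w52 — the rank-two member
# `f = x₀x₁ + x₂³`, `I = (f) + 𝔪⁴` IS IN THE CLASS 𝒞 (unconditional core rung)

[OURS · L1 W5.2 · rung] The twice-repaired companion (design note NEXT-two-planes-cube.md,
Addenda 8–12, kit j282646 / j286610 / j288133):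
`Q = 𝔪ᴺ · A · J_q′ · J_π · A₃ · A₄ · 𝔪`, `A = (f) + x₀𝔪 + 𝔪³`,
`J_q′ = (x₀) + (x₁,x₂)(x₁,x₂,x₃) + (x₃³) + 𝔪³` (point avatar),
`J_π = (x₀, x₁x₃, x₂x₃)² + (x₀x₁², x₀x₂², x₁⁴, x₂⁴, x₃⁵) + 𝔪⁵` (plane avatar), `A₃ = (f) + 𝔪³`,
`A₄ = (f) + x₀𝔪² + 𝔪⁴`.  `Bl_{Q·I} Spec S` is `Bl_𝔪` followed, chart by chart, by regular centres
only: `B₀` two-letter tower; `B₁` plane + unit flag; `B₂` plane + graph/hyperbola curves; `B₃`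
plane, then the point `q` of the `A₂` surface, then the plane `E′_{Π₀} ∩ E_q`, then letter towers
on the strict transform of the `A₂` surface (a graph on every chart).

* `map_chartBase_tpJq'_one`, `map_tpAllPi_zero/one/two` — the remaining `S`-level images;
* `isRegular_of_isBlowup_tpAllPi_zero/one/two` — charts `B₀`, `B₁`, `B₂`;
* **`coreRung_twoPlanes`** — for every regular local `S` of embedding dimension four with regular
  system of parameters `x`, every blowing up `T = Bl_I Spec S`, `I = (x₀x₁ + x₂³) + 𝔪⁴`, carries a
  non-zero ideal sheaf cosupported over the closed point whose blowing up is regular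
  (the `AtomDimFourBlowupAt`-shaped conclusion; FORMAT evidence for the open core
  `stub_atomDimFourBlowup`: the first member with a rank-two initial form, contact migration along
  a line and an `A₂ × line` point).

Nothing here is a statement of the manuscript under review.

## References

* The Stacks Project, Tags 080A, 080B. [StacksProject]
* U. Görtz, T. Wedhorn, *Algebraic Geometry I*, 2nd ed. 2020, Prop. 13.91 (2). [GortzWedhorn2020]
* Q. Liu, *Algebraic Geometry and Arithmetic Curves*, OUP 2002, Thm. 8.1.19 (a). [Liu2002]
-/

-- `Summit.<Summit>.<Sub>.Theorems` with `Sub = Summit` (single-conjunct summit, D-0017)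
set_option linter.dupNamespace false

noncomputable section

open CategoryTheory CategoryTheory.Limits AlgebraicGeometry Literature.AlgebraicGeometry.Resolution
open IsLocalRing

namespace Summit.ResolutionOfSingularities.ResolutionOfSingularities.Theorems

namespace TwoPlanesRung

open ConeRung

universe u

/-- Reordering on `B₀`. [folklore] -/
theorem tp_allPi_product_zero {B : Type*} [CommRing B] (W P3 P4 PI : Ideal B) (N : ℕ) :
    W ^ N * W ^ 2 * W * W ^ 2 * P3 * P4 * PI = W ^ (N + 5) * (P3 * P4 * PI) := by
  ring

/-- Reordering on `B₁`, `B₂`. [folklore] -/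
theorem tp_allPi_product_one {B : Type*} [CommRing B] (W P X1 X2 X3 : Ideal B) (N : ℕ) :
    W ^ N * (W ^ 2 * P) * (W * P) * (W ^ 2 * P ^ 2) * (W ^ 2 * X1) * (W ^ 2 * X2) * (W ^ 2 * X3) =
      W ^ (N + 11) * ((X1 * X2 * X3 * P ^ 3) * P) := by
  ring

section RungPi

variable {S : Type u} [CommRing S] [IsRegularLocalRing S] (x : Fin 4 → S)
  (hx : Ideal.span (Set.range x) = IsLocalRing.maximalIdeal S)
  (hd : (IsLocalRing.maximalIdeal S).spanFinrank = 4)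

local notation3 (prettyPrint := false) "M" => Ideal.span (Set.range x)
local notation3 (prettyPrint := false) "fT" => x 0 * x 1 + x 2 ^ 3
local notation3 (prettyPrint := false) "tpA" => Ideal.span {x 0 * x 1 + x 2 ^ 3} ⊔
  Ideal.span {x 0} * Ideal.span (Set.range x) ⊔ Ideal.span (Set.range x) ^ 3
local notation3 (prettyPrint := false) "tpJq'" => (Ideal.span {x 0} ⊔ Ideal.span {x 1, x 2} * Ideal.span {x 1, x 2, x 3} ⊔
  Ideal.span {x 3 ^ 3}) ⊔ Ideal.span (Set.range x) ^ 3
local notation3 (prettyPrint := false) "tpJpi" => Ideal.span {x 0, x 1 * x 3, x 2 * x 3} ^ 2 ⊔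
  Ideal.span {x 0 * x 1 ^ 2, x 0 * x 2 ^ 2, x 1 ^ 4, x 2 ^ 4, x 3 ^ 5} ⊔ Ideal.span (Set.range x) ^ 5
local notation3 (prettyPrint := false) "tpA3" => Ideal.span {x 0 * x 1 + x 2 ^ 3} ⊔ Ideal.span (Set.range x) ^ 3
local notation3 (prettyPrint := false) "tpA4" => Ideal.span {x 0 * x 1 + x 2 ^ 3} ⊔
  Ideal.span {x 0} * Ideal.span (Set.range x) ^ 2 ⊔ Ideal.span (Set.range x) ^ 4
local notation3 (prettyPrint := false) "tpI" => Ideal.span {x 0 * x 1 + x 2 ^ 3} ⊔ Ideal.span (Set.range x) ^ 4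
/-- chart-side notations for `B_i`, `i = 1, 2` -/
local notation3 (prettyPrint := false) "II[" i "]" => Ideal.span (Set.range
  (Fin.cons (chartBase x i (x i)) (fun _ : Fin 1 => chartGen x i 0) : Fin 2 → chartRing x i))
local notation3 (prettyPrint := false) "J[" i "]" => Ideal.span {chartGen x i 0 * chartGen x i 1, chartBase x i (x i)} *
    (Ideal.span {chartGen x i 0 * chartGen x i 1 + chartBase x i (x i) * chartGen x i 2 ^ 3} ⊔
      Ideal.span {chartBase x i (x i)} * Ideal.span {chartGen x i 0} ⊔ Ideal.span {chartBase x i (x i)} ^ 2) *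
    (Ideal.span {chartGen x i 0 * chartGen x i 1 + chartBase x i (x i) * chartGen x i 2 ^ 3} ⊔
      Ideal.span {chartBase x i (x i)} ^ 2)

omit [IsRegularLocalRing S] in
/-- **`J_q′ B₁ = (u)(e₀, u)`** (`x₀ ↦ u e₀`; `(x₁,x₂) ↦ (u)` since `e₁ = 1`; `x₃³ ↦ u³e₃³`).
[cite: StacksProject, Tag 080B] -/
theorem map_chartBase_tpJq'_one :
    (tpJq').map (chartBase x 1) = Ideal.span {chartBase x 1 (x 1)} * Ideal.span {chartGen x 1 0, chartBase x 1 (x 1)} := by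
  have hu : chartBase x 1 (x 1) ∈ Ideal.span {chartBase x 1 (x 1)} := Ideal.mem_span_singleton_self _
  have hP : (Ideal.span {x 1, x 2}).map (chartBase x 1) = Ideal.span {chartBase x 1 (x 1)} := by
    rw [Ideal.map_span, Set.image_pair, reesChartBase_apply_eq_mul_chartGen x 1 2]
    exact le_antisymm (Ideal.span_le.mpr (Set.pair_subset_iff.mpr ⟨hu, Ideal.mul_mem_right _ _ hu⟩))
      (Ideal.span_mono (Set.singleton_subset_iff.mpr (Set.mem_insert _ _)))
  have hT : (Ideal.span {x 1, x 2, x 3}).map (chartBase x 1) = Ideal.span {chartBase x 1 (x 1)} := by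
    rw [Ideal.map_span, Set.image_insert_eq, Set.image_pair, reesChartBase_apply_eq_mul_chartGen x 1 2,
      reesChartBase_apply_eq_mul_chartGen x 1 3]
    exact le_antisymm (Ideal.span_le.mpr (Set.insert_subset_iff.mpr ⟨hu, Set.pair_subset_iff.mpr
      ⟨Ideal.mul_mem_right _ _ hu, Ideal.mul_mem_right _ _ hu⟩⟩))
      (Ideal.span_mono (Set.singleton_subset_iff.mpr (Set.mem_insert _ _)))
  have h3 : (Ideal.span {x 3 ^ 3}).map (chartBase x 1) ≤ Ideal.span {chartBase x 1 (x 1)} ^ 2 := by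
    rw [Ideal.map_span, Set.image_singleton, map_pow, reesChartBase_apply_eq_mul_chartGen x 1 3,
      Ideal.span_singleton_le_iff_mem]
    exact Ideal.pow_le_pow_right (by norm_num) (Ideal.pow_mem_pow (Ideal.mul_mem_right _ _ hu) 3)
  have hM : (M ^ 3).map (chartBase x 1) ≤ Ideal.span {chartBase x 1 (x 1)} ^ 2 := by
    rw [Ideal.map_pow, ConeRung.map_chartBase_M]
    exact Ideal.pow_le_pow_right (by norm_num)
  rw [Ideal.map_sup, Ideal.map_sup, Ideal.map_sup, Ideal.map_mul, map_chartBase_span_x0, hP, hT, ← pow_two,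
    sup_eq_left.mpr (h3.trans le_sup_right), sup_eq_left.mpr (hM.trans le_sup_right), pow_two, ← Ideal.mul_sup,
    ← Ideal.span_insert]

omit [IsRegularLocalRing S] in
/-- `𝔪ᴺ·A·J_q′·J_π·A₃·A₄·I ↦ (u)^{N+5}·(A₃A₄I)B₀` on `B₀`. [cite: StacksProject, Tag 080B] -/
theorem map_tpAllPi_zero (N : ℕ) :
    (M ^ N * tpA * tpJq' * tpJpi * tpA3 * tpA4 * tpI).map (chartBase x 0) =
      Ideal.span {chartBase x 0 (x 0)} ^ (N + 5) * ((tpA3 * tpA4 * tpI).map (chartBase x 0)) := by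
  rw [Ideal.map_mul, Ideal.map_mul, Ideal.map_mul, Ideal.map_mul, Ideal.map_mul, Ideal.map_mul, Ideal.map_pow,
    ConeRung.map_chartBase_M, map_tpA_zero, map_chartBase_tpJq'_zero, map_chartBase_tpJpi_zero, Ideal.map_mul,
    Ideal.map_mul]
  exact tp_allPi_product_zero _ _ _ _ N

omit [IsRegularLocalRing S] in
/-- `𝔪ᴺ·A·J_q′·J_π·A₃·A₄·I ↦ (u^{N+11})·((J₁·(u,e₀)³)·(u,e₀))` on `B₁`. [cite: StacksProject, Tag 080B] -/
theorem map_tpAllPi_one (N : ℕ) :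
    (M ^ N * tpA * tpJq' * tpJpi * tpA3 * tpA4 * tpI).map (chartBase x 1) =
      Ideal.span {chartBase x 1 (x 1) ^ (N + 11)} * ((J[1] * II[1] ^ 3) * II[1]) := by
  rw [Ideal.map_mul, Ideal.map_mul, Ideal.map_mul, Ideal.map_mul, Ideal.map_mul, Ideal.map_mul, Ideal.map_pow,
    ConeRung.map_chartBase_M, map_chartBase_tpA, map_chartBase_tpJq'_one, map_chartBase_tpJpi_one,
    map_chartBase_tpA3, map_chartBase_tpA4, map_chartBase_tpI, span_range_plane, ← Ideal.span_singleton_pow]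
  exact tp_allPi_product_one _ (Ideal.span {chartGen x 1 0, chartBase x 1 (x 1)}) _ _ _ N

omit [IsRegularLocalRing S] in
/-- `𝔪ᴺ·A·J_q′·J_π·A₃·A₄·I ↦ (u^{N+11})·((J₂·(u,e₀)³)·(u,e₀))` on `B₂`. [cite: StacksProject, Tag 080B] -/
theorem map_tpAllPi_two (N : ℕ) :
    (M ^ N * tpA * tpJq' * tpJpi * tpA3 * tpA4 * tpI).map (chartBase x 2) =
      Ideal.span {chartBase x 2 (x 2) ^ (N + 11)} * ((J[2] * II[2] ^ 3) * II[2]) := by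
  rw [Ideal.map_mul, Ideal.map_mul, Ideal.map_mul, Ideal.map_mul, Ideal.map_mul, Ideal.map_mul, Ideal.map_pow,
    ConeRung.map_chartBase_M, map_chartBase_tpA, map_chartBase_tpJq'_two, map_chartBase_tpJpi_two,
    map_chartBase_tpA3, map_chartBase_tpA4, map_chartBase_tpI, span_range_plane, ← Ideal.span_singleton_pow]
  exact tp_allPi_product_one _ (Ideal.span {chartGen x 2 0, chartBase x 2 (x 2)}) _ _ _ N

include hx hd in
/-- **Chart `B₀`.** [cite: StacksProject, Tag 080A] -/
theorem isRegular_of_isBlowup_tpAllPi_zero (N : ℕ) {Y : Scheme.{u}} {ρ : Y ⟶ Spec (.of (chartRing x 0))}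
    (hρ : IsBlowup ρ (affineBlowup.idealSheaf ((M ^ N * tpA * tpJq' * tpJpi * tpA3 * tpA4 * tpI).map (chartBase x 0)))) :
    Scheme.IsRegular Y := by
  rw [map_tpAllPi_zero] at hρ
  exact isRegular_of_isBlowup_tpProd_zero x hx hd (N + 5) hρ

include hx hd in
/-- **Chart `B₁`.** [cite: StacksProject, Tag 080A] -/
theorem isRegular_of_isBlowup_tpAllPi_one (N : ℕ) {Y : Scheme.{u}} {ρ : Y ⟶ Spec (.of (chartRing x 1))}
    (hρ : IsBlowup ρ (affineBlowup.idealSheaf ((M ^ N * tpA * tpJq' * tpJpi * tpA3 * tpA4 * tpI).map (chartBase x 1)))) :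
    Scheme.IsRegular Y := by
  rw [map_tpAllPi_one] at hρ
  exact isRegular_of_isBlowup_tpPlane_coreOne x hx hd 3 (N + 11) hρ

include hx hd in
/-- **Chart `B₂`.** [cite: StacksProject, Tag 080A] -/
theorem isRegular_of_isBlowup_tpAllPi_two (N : ℕ) {Y : Scheme.{u}} {ρ : Y ⟶ Spec (.of (chartRing x 2))}
    (hρ : IsBlowup ρ (affineBlowup.idealSheaf ((M ^ N * tpA * tpJq' * tpJpi * tpA3 * tpA4 * tpI).map (chartBase x 2)))) :
    Scheme.IsRegular Y := by
  rw [map_tpAllPi_two] at hρ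
  exact isRegular_of_isBlowup_tpPlane_corePow_two x hx hd 2 rfl 3 (N + 11) hρ

omit [IsRegularLocalRing S] in
/-- **`𝔪^{N+18} ≤ 𝔪ᴺ·A·J_q′·J_π·A₃·A₄`.** [folklore] -/
theorem pow_le_tpQ0_pi (N : ℕ) : M ^ (N + 18) ≤ M ^ N * tpA * tpJq' * tpJpi * tpA3 * tpA4 := by
  rw [show N + 18 = N + 3 + 3 + 5 + 3 + 4 by ring, pow_add, pow_add, pow_add, pow_add, pow_add]
  exact Ideal.mul_mono (Ideal.mul_mono (Ideal.mul_mono (Ideal.mul_mono (Ideal.mul_mono le_rfl le_sup_right)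
    le_sup_right) le_sup_right) le_sup_right) le_sup_right

include hx hd in
/-- **CORE RUNG — the rank-two member `I = (x₀x₁ + x₂³) + 𝔪⁴` is in the class 𝒞, UNCONDITIONALLY.**
For every regular local ring `S` of embedding dimension four with regular system of parameters `x`,
every blowing up `T = Bl_I Spec S` carries a non-zero ideal sheaf cosupported in the closed fibre
whose blowing up is a regular scheme: `J = Q·𝒪_T` with the twice-repaired companion
`Q = 𝔪ᴺ·A·J_q′·J_π·A₃·A₄·𝔪`. [cite: StacksProject, Tag 080A] [cite: GortzWedhorn2020, Prop. 13.91 (2)]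
[cite: Liu2002, Thm. 8.1.19 (a)] -/
theorem coreRung_twoPlanes (N : ℕ) (T : Scheme.{u}) (f : T ⟶ Spec (.of S))
    (hf : IsBlowup f (affineBlowup.idealSheaf (Ideal.span {fT} ⊔ IsLocalRing.maximalIdeal S ^ 4))) :
    ∃ (J : T.IdealSheafData) (T' : Scheme.{u}) (π : T' ⟶ T), J ≠ ⊥ ∧
      (∀ t : T, t ∈ J.support → f.base t = IsLocalRing.closedPoint S) ∧
      IsBlowup π J ∧ Scheme.IsRegular T' := by
  haveI : IsDomain S := isDomain_of_isRegularLocalRing S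
  have hx0 : x 0 ≠ 0 := (isRsopPart_comp_of_rsop hd x hx id Function.injective_id).ne_zero 0
  have h𝔪 : IsLocalRing.maximalIdeal S ≠ ⊥ := fun h => hx0 (by
    have := hx.le (Ideal.subset_span (Set.mem_range_self 0)); rw [h] at this
    exact (Submodule.mem_bot S).mp this)
  rw [← hx] at hf
  have hI : (tpI) ≠ ⊥ := fun h => pow_ne_zero 4 h𝔪 (by
    rw [← hx]; exact eq_bot_iff.mpr (le_sup_right.trans h.le))
  have hQ₀ : IsLocalRing.maximalIdeal S ^ (N + 18) ≤ M ^ N * tpA * tpJq' * tpJpi * tpA3 * tpA4 := by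
    rw [← hx]; exact pow_le_tpQ0_pi x N
  refine atomConclusion_of_pointBlowup_charts x hx h𝔪 hI hQ₀ (fun i Y ρ hρ => ?_) T f hf
  rw [mul_comm (tpI) (M ^ N * tpA * tpJq' * tpJpi * tpA3 * tpA4)] at hρ
  fin_cases i
  · exact isRegular_of_isBlowup_tpAllPi_zero x hx hd N hρ
  · exact isRegular_of_isBlowup_tpAllPi_one x hx hd N hρ
  · exact isRegular_of_isBlowup_tpAllPi_two x hx hd N hρ
  · exact isRegular_of_isBlowup_tpAllPi_three x hx hd N hρ

end RungPi

end TwoPlanesRung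

end Summit.ResolutionOfSingularities.ResolutionOfSingularities.Theorems

end
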